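import Literature.Computability.Complexity.DegreeThreeEncoding
import Mathlib.Tactic.LinearCombination
import Mathlib.Tactic.Ring
import HarnessLib

/-!
# Randomizing polynomials V-b: the degree-3 encoding is a perfect extension

The algebra of perfect extensions in the valuation language of file IV and its application to the
encodings of file V [Applebaum–Ishai–Kushilevitz 2006, §4 (composition and concatenation of perfect
randomized encodings); Dvir–Gutfreund–Rothblum–Vadhan 2010, Thm 4.5]:

* `PerfExt.congr_target`, `perfExt_nil`, **`PerfExt.chain`** (sum splitting: a perfect extension of
  `g + r` on `[n+1, n₁)` followed by one of `r + h` on `[n₁, n₂)`, `r` the mask at `n`, is a perfect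
  extension of `g + h` on `[n, n₂)`), **`PerfExt.append`** (concatenation with disjoint fresh blocks);
* `perfExt_encodePolyAux`, `perfExt_encodePoly`, **`perfExt_encodeMap`**: `(encodeMap n P).2` is a
  perfect extension of `v ↦ evalM v P` with fresh variables `[n, (encodeMap n P).1)`.

## References

* B. Applebaum, Y. Ishai, E. Kushilevitz, SIAM J. Comput. 36 (2006), §4.
* Z. Dvir, D. Gutfreund, G. N. Rothblum, S. Vadhan, ECCC TR10-160 (2010), Thm 4.5.
-/

namespace Literature.Computability.Complexity

namespace RandPoly

variable {v w : ℕ → ZMod 2}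

/-! ### Algebra of perfect extensions -/

section Algebra

variable {β β' : Type} {n n' : ℕ} {O : List (List (List ℕ))}

/-- Changing the target to one with the same fibres. [folklore] -/
theorem PerfExt.congr_target {f : (ℕ → ZMod 2) → β} {f' : (ℕ → ZMod 2) → β'} (h : PerfExt n n' O f)
    (hff' : ∀ v w, f v = f w ↔ f' v = f' w) : PerfExt n n' O f' :=
  ⟨h.inj, fun v w he => (hff' v w).1 (h.dec v w he), fun v w hf => h.range v w ((hff' v w).2 hf)⟩

/-- The empty block is a perfect extension of a constant target. [folklore] -/
theorem perfExt_nil {f : (ℕ → ZMod 2) → β} (hf : ∀ v w, f v = f w) (n : ℕ) : PerfExt n n [] f :=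
  ⟨fun _ _ h _ => h, fun v w _ => hf v w, fun _ w _ => ⟨w, AgreeBelow.refl w, rfl⟩⟩

/-- **Sum splitting (chain rule).** If `O₁` perfectly extends `g + r` with fresh variables
`[n+1, n₁)` and `O₂` perfectly extends `r + h` with fresh variables `[n₁, n₂)`, where `r = v n` is
the mask, `g` and `h` depend only on variables below `n`, `O₁` uses only variables below `n₁` and
`O₂` avoids `[n+1, n₁)`, then `O₁ ++ O₂` perfectly extends `g + h` with fresh variables `[n, n₂)`.
[cite: ApplebaumIshaiKushilevitz2006, §4 (composition of randomized encodings)] -/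
theorem PerfExt.chain {n n₁ n₂ : ℕ} {O₁ O₂ : List (List (List ℕ))} {g h : (ℕ → ZMod 2) → ZMod 2}
    (hn : n + 1 ≤ n₁) (hg : ∀ v w, AgreeBelow n v w → g v = g w)
    (hh : ∀ v w, AgreeBelow n v w → h v = h w)
    (h₁ : PerfExt (n + 1) n₁ O₁ (fun v => g v + v n)) (h₂ : PerfExt n₁ n₂ O₂ (fun v => v n + h v))
    (hO₁ : VarsIn (fun x => x < n₁) O₁) (hO₂ : VarsIn (fun x => x < n + 1 ∨ n₁ ≤ x) O₂) :
    PerfExt n n₂ (O₁ ++ O₂) (fun v => g v + h v) := by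
  refine ⟨fun v w hvw he => ?_, fun v w he => ?_, fun v w hf => ?_⟩
  · obtain ⟨he₁, he₂⟩ := evalM_append_inj.1 he
    have hd₂ : v n + h v = w n + h w := h₂.dec v w he₂
    rw [hh v w hvw] at hd₂
    have hn' : v n = w n := add_right_cancel hd₂
    have hvw1 : AgreeBelow (n + 1) v w := fun i hi => by
      rcases Nat.lt_succ_iff_lt_or_eq.1 hi with hi | rfl
      · exact hvw i hi
      · exact hn'
    exact h₂.inj v w (h₁.inj v w hvw1 he₁) he₂
  · obtain ⟨he₁, he₂⟩ := evalM_append_inj.1 he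
    have hd₁ : g v + v n = g w + w n := h₁.dec v w he₁
    have hd₂ : v n + h v = w n + h w := h₂.dec v w he₂
    show g v + h v = g w + h w
    calc g v + h v = g v + v n + (v n + h v) := by rw [add_assoc, ← add_assoc (v n), CharTwo.add_self_eq_zero, zero_add]
      _ = g w + w n + (w n + h w) := by rw [hd₁, hd₂]
      _ = g w + h w := by rw [add_assoc, ← add_assoc (w n), CharTwo.add_self_eq_zero, zero_add]
  · replace hf : g v + h v = g w + h w := hf
    -- realise the second block over `w` with the mask adjusted, then the first block
    set β₂ : ZMod 2 := v n + h v with hβ₂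
    set w' : ℕ → ZMod 2 := Function.update w n (β₂ + h w) with hw'
    have hw'w : AgreeBelow n w' w := fun i hi => by rw [hw', Function.update_of_ne (ne_of_lt hi)]
    have ht₂ : v n + h v = w' n + h w' := by
      rw [hh w' w hw'w, hw', Function.update_self, add_assoc, CharTwo.add_self_eq_zero, add_zero]
    obtain ⟨u₂, hu₂w', hu₂e⟩ := h₂.range v w' ht₂
    have hu₂w : AgreeBelow n u₂ w := (hu₂w'.mono (by omega)).trans hw'w
    have ht₁ : g v + v n = g u₂ + u₂ n := by
      rw [hg u₂ w hu₂w, hu₂w' n (by omega), hw', Function.update_self, hβ₂]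
      have h3 : g w = g v + h v + h w := by
        rw [hf, add_assoc, CharTwo.add_self_eq_zero, add_zero]
      rw [h3]
      have h2 : (2 : ZMod 2) = 0 := by decide
      linear_combination (-(h v + h w)) * h2
    obtain ⟨u₁, hu₁u₂, hu₁e⟩ := h₁.range v u₂ ht₁
    refine ⟨fun i => if i < n₁ then u₁ i else u₂ i, fun i hi => ?_, ?_⟩
    · simp only [if_pos (show i < n₁ by omega)]
      exact (hu₁u₂ i (by omega)).trans (hu₂w i hi)
    · rw [evalM_append, evalM_append]
      congr 1
      · rw [← hu₁e]
        exact evalM_congr_of_varsIn hO₁ fun x hx => by simp [hx]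
      · rw [← hu₂e]
        refine evalM_congr_of_varsIn hO₂ fun x hx => ?_
        rcases hx with hx | hx
        · simp only [if_pos (show x < n₁ by omega)]; exact hu₁u₂ x hx
        · simp only [if_neg (show ¬ x < n₁ by omega)]

/-- **Concatenation.** If `O₁` perfectly extends `f₁` with fresh variables `[n, n₁)` and `O₂`
perfectly extends `f₂` with fresh variables `[n₁, n₂)`, the first target depending only on variables
below `n`, `O₁` using only variables below `n₁` and `O₂` avoiding `[n, n₁)`, then `O₁ ++ O₂`
perfectly extends `(f₁, f₂)` with fresh variables `[n, n₂)`.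
[cite: ApplebaumIshaiKushilevitz2006, §4 (concatenation of randomized encodings)] -/
theorem PerfExt.append {β₁ β₂ : Type} {n n₁ n₂ : ℕ} {O₁ O₂ : List (List (List ℕ))}
    {f₁ : (ℕ → ZMod 2) → β₁} {f₂ : (ℕ → ZMod 2) → β₂} (hn : n ≤ n₁)
    (hf₁ : ∀ v w, AgreeBelow n v w → f₁ v = f₁ w)
    (h₁ : PerfExt n n₁ O₁ f₁) (h₂ : PerfExt n₁ n₂ O₂ f₂)
    (hO₁ : VarsIn (fun x => x < n₁) O₁) (hO₂ : VarsIn (fun x => x < n ∨ n₁ ≤ x) O₂) :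
    PerfExt n n₂ (O₁ ++ O₂) (fun v => (f₁ v, f₂ v)) := by
  refine ⟨fun v w hvw he => ?_, fun v w he => ?_, fun v w hf => ?_⟩
  · obtain ⟨he₁, he₂⟩ := evalM_append_inj.1 he
    exact h₂.inj v w (h₁.inj v w hvw he₁) he₂
  · obtain ⟨he₁, he₂⟩ := evalM_append_inj.1 he
    exact Prod.ext (h₁.dec v w he₁) (h₂.dec v w he₂)
  · simp only [Prod.mk.injEq] at hf
    obtain ⟨u₂, hu₂w, hu₂e⟩ := h₂.range v w hf.2
    have hf₁' : f₁ v = f₁ u₂ := hf.1.trans (hf₁ w u₂ (hu₂w.mono hn).symm)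
    obtain ⟨u₁, hu₁u₂, hu₁e⟩ := h₁.range v u₂ hf₁'
    refine ⟨fun i => if i < n₁ then u₁ i else u₂ i, fun i hi => ?_, ?_⟩
    · simp only [if_pos (show i < n₁ by omega)]
      exact (hu₁u₂ i hi).trans (hu₂w i (by omega))
    · rw [evalM_append, evalM_append]
      congr 1
      · rw [← hu₁e]
        exact evalM_congr_of_varsIn hO₁ fun x hx => by simp [hx]
      · rw [← hu₂e]
        refine evalM_congr_of_varsIn hO₂ fun x hx => ?_
        rcases hx with hx | hx
        · simp only [if_pos (show x < n₁ by omega)]; exact hu₁u₂ x hx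
        · simp only [if_neg (show ¬ x < n₁ by omega)]

end Algebra

/-! ### The encodings are perfect extensions -/

/-- Value of an appended mask list. [folklore] -/
theorem rhoOf_append_singleton (ρ : List ℕ) (r : ℕ) (v : ℕ → ZMod 2) :
    rhoOf (ρ ++ [r]) v = rhoOf ρ v + v r := by
  simp [rhoOf, List.sum_append]

/-- **`encodePolyAux` is a perfect extension of `masks + polynomial`.** [cite: DvirGutfreundRothblumVadhan2010, Thm 4.5] -/
theorem perfExt_encodePolyAux (n : ℕ) (ρ : List ℕ) (p : List (List ℕ)) (hp : ∀ T ∈ p, T ≠ [])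
    (hpne : p ≠ []) (hpn : ∀ T ∈ p, ∀ x ∈ T, x < n) (hρ : ∀ r ∈ ρ, r < n) :
    PerfExt n (encodePolyAux n ρ p).1 (encodePolyAux n ρ p).2 (fun v => rhoOf ρ v + evalP v p) := by
  induction p generalizing n ρ with
  | nil => exact absurd rfl hpne
  | cons T rest ih =>
    have hTne : T ≠ [] := hp T (by simp)
    have hTl : T.length = (T.length - 1) + 1 := by
      have := List.length_pos_of_ne_nil hTne; omega
    have hTn : ∀ x ∈ T, x < n := hpn T (by simp)
    cases rest with
    | nil =>
      refine (perfExt_ikBlock n hTl hTn hρ).congr_target fun v w => ?_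
      simp only [evalP_cons, evalP_nil, add_zero]
      rw [add_comm (rhoOf ρ v), add_comm (rhoOf ρ w)]
    | cons T' rest =>
      -- block of `T` with masks `ρ ++ [n]`, variables from `n + 1`
      have hρ' : ∀ r ∈ ρ ++ [n], r < n + 1 := fun r hr => by
        rw [List.mem_append, List.mem_singleton] at hr
        rcases hr with hr | rfl
        · exact Nat.lt_succ_of_lt (hρ r hr)
        · exact Nat.lt_succ_self _
      have h₁ := perfExt_ikBlock (n + 1) hTl (fun x hx => Nat.lt_succ_of_lt (hTn x hx)) hρ'
      -- the rest with incoming mask `[n]`, variables from `n₁`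
      set n₁ := n + 1 + blockSize T with hn₁
      have hrest : ∀ T'' ∈ T' :: rest, T'' ≠ [] := fun T'' hT'' => hp T'' (List.mem_cons_of_mem _ hT'')
      have h₂ := ih n₁ [n] hrest (List.cons_ne_nil _ _)
        (fun T'' hT'' x hx => by
          have := hpn T'' (List.mem_cons_of_mem _ hT'') x hx; omega)
        (fun r hr => by rw [List.mem_singleton] at hr; rw [hr]; omega)
      have hchain := PerfExt.chain (n := n) (n₁ := n₁) (g := fun v => (T.map v).prod + rhoOf ρ v)
        (h := fun v => evalP v (T' :: rest)) (by omega)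
        (fun v w hvw => by
          show (T.map v).prod + rhoOf ρ v = (T.map w).prod + rhoOf ρ w
          rw [List.map_congr_left fun x hx => hvw x (hTn x hx), rhoOf_congr hρ hvw])
        (fun v w hvw => evalP_congr_below
          (fun μ hμ x hx => hpn μ (List.mem_cons_of_mem _ hμ) x hx) hvw)
        (h₁.congr_target fun v w => by simp only [rhoOf_append_singleton, add_assoc])
        (h₂.congr_target fun v w => by simp [rhoOf])
        (fun q hq μ hμ x hx => by
          rcases (mem_ikBlock hTne hq hμ).2 x hx with h | h | h
          · have := hTn x h; omega
          · have := hρ' x h; omega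
          · unfold blockSize at hn₁; omega)
        ((varsIn_encodePolyAux n₁ [n] (T' :: rest) hrest).mono fun x hx => by
          rcases hx with ⟨T'', hT'', hxT⟩ | hx | hx
          · have := hpn T'' (List.mem_cons_of_mem _ hT'') x hxT; omega
          · rw [List.mem_singleton] at hx; omega
          · omega)
      refine hchain.congr_target fun v w => ?_
      simp only [evalP_cons]
      constructor <;> intro h <;> linear_combination h

/-- The empty monomials shift the value by a constant. [folklore] -/
theorem evalP_add_evalP_filter (p : List (List ℕ)) (v w : ℕ → ZMod 2) :
    evalP v p + evalP w (p.filter (· ≠ [])) = evalP w p + evalP v (p.filter (· ≠ [])) := by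
  induction p with
  | nil => simp
  | cons μ p ih =>
    by_cases hμ : μ = []
    · subst hμ
      have e : List.filter (fun x => decide (x ≠ [])) (([] : List ℕ) :: p) =
          List.filter (fun x => decide (x ≠ [])) p := by simp
      rw [e, evalP_cons, evalP_cons]
      simp only [List.map_nil, List.prod_nil]
      linear_combination ih
    · have e : List.filter (fun x => decide (x ≠ [])) (μ :: p) =
          μ :: List.filter (fun x => decide (x ≠ [])) p := by simp [hμ]
      rw [e, evalP_cons, evalP_cons, evalP_cons, evalP_cons]
      linear_combination ih

/-- **`encodePoly` is a perfect extension of the value of the polynomial.**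
[cite: DvirGutfreundRothblumVadhan2010, Thm 4.5] -/
theorem perfExt_encodePoly (n : ℕ) (p : List (List ℕ)) (hpn : ∀ T ∈ p, ∀ x ∈ T, x < n) :
    PerfExt n (encodePoly n p).1 (encodePoly n p).2 (fun v => evalP v p) := by
  have key : PerfExt n (encodePoly n p).1 (encodePoly n p).2 (fun v => evalP v (p.filter (· ≠ []))) := by
    unfold encodePoly
    by_cases hp : p.filter (· ≠ []) = []
    · rw [hp]
      exact perfExt_nil (fun v w => rfl) n
    · refine (perfExt_encodePolyAux n [] _ (fun T hT => of_decide_eq_true (List.mem_filter.1 hT).2) hp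
        (fun T hT x hx => hpn T (List.mem_filter.1 hT).1 x hx) (fun r hr => absurd hr List.not_mem_nil)).congr_target
        fun v w => ?_
      simp [rhoOf]
  refine key.congr_target fun v w => ?_
  have h := evalP_add_evalP_filter p v w
  constructor
  · intro h'; linear_combination h' + h
  · intro h'; linear_combination h' - h

/-- **`encodeMap` is a perfect extension of the value of the map** (fresh variables
`[n, (encodeMap n P).1)`). [cite: DvirGutfreundRothblumVadhan2010, Thm 4.5] -/
theorem perfExt_encodeMap (n : ℕ) (P : List (List (List ℕ))) (hPn : VarsIn (fun x => x < n) P) :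
    PerfExt n (encodeMap n P).1 (encodeMap n P).2 (fun v => evalM v P) := by
  induction P generalizing n with
  | nil => exact perfExt_nil (fun v w => rfl) n
  | cons p P ih =>
    have hp : ∀ T ∈ p, ∀ x ∈ T, x < n := hPn p (by simp)
    have hP : VarsIn (fun x => x < n) P := fun q hq => hPn q (List.mem_cons_of_mem _ hq)
    have hle₁ := le_encodePoly_fst n p
    have h₁ := perfExt_encodePoly n p hp
    have h₂ := ih (encodePoly n p).1 (hP.mono fun x hx => lt_of_lt_of_le hx hle₁)
    have happ := PerfExt.append hle₁ (fun v w hvw => evalP_congr_below hp hvw) h₁ h₂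
      ((varsIn_encodePoly n p).mono fun x hx => by
        rcases hx with ⟨T, hT, hxT⟩ | hx
        · exact lt_of_lt_of_le (hp T hT x hxT) hle₁
        · exact hx.2)
      ((varsIn_encodeMap (encodePoly n p).1 P).mono fun x hx => by
        rcases hx with ⟨q, hq, T, hT, hxT⟩ | hx
        · exact Or.inl (hP q hq T hT x hxT)
        · exact Or.inr hx.1)
    refine happ.congr_target fun v w => ?_
    simp only [evalM, List.map_cons, List.cons.injEq, Prod.mk.injEq]

end RandPoly

end Literature.Computability.Complexity
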